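import Summits.AtomisticToContinuum.FouriersLaw.Theorems.BondHeatUncertaintyBoundedResponseBathHeatLogWindowA
import HarnessLib

/-!
# BondHeatUncertainty / BoundedResponse — «LogWindow» §10: HORIZON and WINDOW as free parameters, the LOG-WINDOW LAW, the general door, and the
polynomial horizon with its LOGARITHMIC window `(HMlog_{a,q})` (part 2 of 4 — overview in the main file `…BathHeatLogWindow`)

Objects: `logWindow τ T N = 8T·(2·log τ_N + 4·log N + 1)`; route Props `HorizonRemainderFloorAt (τ : ℕ → ℝ) (g : ℝ)`, `HorizonReturnMonotoneWithin
(a : ℝ) (τ : ℕ → ℝ) (w : ℝ → ℕ → ℝ)` (NODE 112's `HorizonRemainderFloor q g` / `HorizonReturnMonotoneOn a q δ` are the points `τ = N^q`, `w = T·N^δ`: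
`horizonRemainderFloor_iff_at`, `horizonReturnMonotoneOn_iff_within`, both `Iff.rfl`), `HorizonReturnMonotoneLog a q` (window `8T((2q+4)·log N + 1)`).
★★ `bathTailLate_floor_of_logWindow` (the local door: remainder floor + confined monotonicity on the LOG window ⟹ `B^late_N ≥ −C·N`);
★★★ `lateTailFloor_one_of_horizonAt_logWindow` (any horizon `τ_N ≥ N³`); ★★★ `lateTailFloor_one_of_horizon_log : 0 ≤ a → 3 ≤ q →
HorizonRemainderFloor q 1 → HorizonReturnMonotoneLog a q → LateTailFloor a 1 1`; ★ `horizonReturnMonotoneLog_of_on : 0 < δ → HorizonReturnMonotoneOn a q δ →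
HorizonReturnMonotoneLog a q` (NODE 113's piece is WEAKER than NODE 112's, by a theorem); the instrumentable sufficient conditions through NODE 110's
`kinKickProfile`; the `(KD_p)`-fed log door. ROUTE STATEMENTS are tagged in their docstrings (UNDECIDED · INSTRUMENTABLE · IDEA-NEEDED · phonon-TRUE;
not literature facts). No `sorry`, no new axioms.
-/

noncomputable section

open MeasureTheory ProbabilityTheory Filter Topology Set Function
open scoped NNReal ENNReal
open Literature.MathematicalPhysics.KineticTheory.HeatConduction
open Literature.MathematicalPhysics.KineticTheory OscillatorChain
open Literature.Probability.Process
open Summit.AtomisticToContinuum.FouriersLaw.Theorems.SubdiffusiveBondHeat (boundaryKernelBasics_proof)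

namespace Summit.AtomisticToContinuum.FouriersLaw.Theorems.BoundedResponse.HeatSpreading

/-! ## §10 (NODE 113) HORIZON and WINDOW as free parameters; the LOG-WINDOW LAW and the general door -/

section LogWindow

variable {ω₂ lam β γ T : ℝ}

/-- **THE LOGARITHMIC KICK WINDOW of a horizon sequence `τ` at temperature `T`**: `W_T(τ; N) := 8T·(2·log τ_N + 4·log N + 1)` — sixteen
thermal energies per e-fold of the horizon, thirty-two per e-fold of the length.  It is exactly the window at which the Gaussian gain
`e^{−W/(8T)} = e^{−1}·τ_N^{−2}·N^{−4}` cancels the free `L²` budget `‖𝔊^{τ_N}_N‖² = O(N⁴·τ_N²)`. [this cell; NEW object] -/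
def logWindow (τ : ℕ → ℝ) (T : ℝ) (N : ℕ) : ℝ :=
  8 * T * (2 * Real.log (τ N) + 4 * Real.log N + 1)

/-- **(HZᶠ[τ]_g) `HorizonRemainderFloorAt τ g`** — NODE 112's horizon-remainder floor at a GENERAL horizon sequence `τ`: eventually
`γ²N²·Rem_N(τ_N) ≥ −C·N^g` (`Rem_N(τ) = ∫_{(τ,∞)} K_N`).  `HorizonRemainderFloor q g` is the case `τ_N = N^q` (`horizonRemainderFloor_iff_at`).
Tag: UNDECIDED at sub-mixing horizons (forecasting ceiling: no checked theorem produces a uniform rate) · TREE-PROVED at every grade at the MIXING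
horizon `τ^mix` (§11 `horizonRemainderFloorAt_mixingHorizon`) · fed by `(KD_p)` at `τ_N = N^q`, `q > p`. [route statement · this cell; NOT a literature fact] -/
def HorizonRemainderFloorAt (τ : ℕ → ℝ) (g : ℝ) : Prop :=
  ∀ ω₂ lam β γ : ℝ, 0 < ω₂ → 0 < lam → 0 < β → 0 < γ → ∀ T : ℝ, 0 < T →
    ∃ C : ℝ, ∃ N₀ : ℕ, ∀ N : ℕ, N₀ ≤ N →
      -(C * (N : ℝ) ^ g) ≤ γ ^ 2 * (N : ℝ) ^ 2 * bathKinRem ω₂ lam β γ T N (τ N)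

/-- **(HM[τ,w]_a) `HorizonReturnMonotoneWithin a τ w`** — CONFINED MONOTONICITY of the horizon-`τ` heat-return curve WITHIN THE WINDOW `w`:
for every `c > 0`, eventually in `N`, `𝔊^{aN,cN²;τ_N}_N` (NODE 112's `horizonReturnProfile`) agrees `ν_T`-a.e. with a function nondecreasing in
`k²` on `k² ≤ w(T,N)`; NOTHING is asked about harder kicks.  `HorizonReturnMonotoneOn a q δ` is the case `τ_N = N^q`, `w = T·N^δ`
(`horizonReturnMonotoneOn_iff_within`).  Antitone in `w` (shrinking the window is free, `of_window_le`); NOT monotone in `τ` (a longer horizon is a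
different curve).  Tag: UNDECIDED · INSTRUMENTABLE (census KICK readouts `Ḡ_{N,u}(k)`, `aN < u ≤ τ_N`, `k² ≤ w`) · IDEA-NEEDED (phonon-TRUE:
exact parabola in `k`). [route statement · this cell; NOT a literature fact] -/
def HorizonReturnMonotoneWithin (a : ℝ) (τ : ℕ → ℝ) (w : ℝ → ℕ → ℝ) : Prop :=
  ∀ ω₂ lam β γ : ℝ, 0 < ω₂ → 0 < lam → 0 < β → 0 < γ → ∀ T : ℝ, 0 < T → ∀ c : ℝ, 0 < c →
    ∃ N₀ : ℕ, ∀ N : ℕ, N₀ ≤ N → ∃ R : ℝ → ℝ,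
      (∀ k₁ k₂ : ℝ, k₁ ^ 2 ≤ k₂ ^ 2 → k₂ ^ 2 ≤ w T N → R k₁ ≤ R k₂) ∧
      horizonReturnProfile ω₂ lam β γ T N (a * (N : ℝ)) (c * (N : ℝ) ^ 2) (τ N) =ᵐ[gaussianReal 0 T.toNNReal] R

/-- NODE 112's `(HZᶠ_{q,g})` IS `(HZᶠ[N^q]_g)` (definitional). [formal bookkeeping] -/
theorem horizonRemainderFloor_iff_at (q : ℕ) (g : ℝ) :
    HorizonRemainderFloor q g ↔ HorizonRemainderFloorAt (fun N => (N : ℝ) ^ q) g := Iff.rfl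

/-- NODE 112's `(HM_{a,q,δ})` IS `(HM[N^q, T·N^δ]_a)` (definitional). [formal bookkeeping] -/
theorem horizonReturnMonotoneOn_iff_within (a : ℝ) (q : ℕ) (δ : ℝ) :
    HorizonReturnMonotoneOn a q δ ↔ HorizonReturnMonotoneWithin a (fun N => (N : ℝ) ^ q) (fun T N => T * (N : ℝ) ^ δ) := Iff.rfl

/-- Grade monotonicity of `(HZᶠ[τ]_g)`: a floor at grade `g` is a floor at every `g' ≥ g`. [formal bookkeeping] -/
theorem HorizonRemainderFloorAt.mono {τ : ℕ → ℝ} {g g' : ℝ} (hgg' : g ≤ g') (h : HorizonRemainderFloorAt τ g) :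
    HorizonRemainderFloorAt τ g' := by
  intro ω₂ lam β γ hω hl hβ hγ T hT
  obtain ⟨C, N₀, hC⟩ := h ω₂ lam β γ hω hl hβ hγ T hT
  refine ⟨max C 0, max N₀ 1, fun N hN => ?_⟩
  have hN1 : (1 : ℝ) ≤ (N : ℝ) := by exact_mod_cast le_trans (le_max_right _ _) hN
  have h1 := hC N (le_trans (le_max_left _ _) hN)
  have h2 : C * (N : ℝ) ^ g ≤ max C 0 * (N : ℝ) ^ g' :=
    calc C * (N : ℝ) ^ g ≤ max C 0 * (N : ℝ) ^ g := mul_le_mul_of_nonneg_right (le_max_left _ _) (Real.rpow_nonneg (by linarith) _)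
      _ ≤ max C 0 * (N : ℝ) ^ g' := mul_le_mul_of_nonneg_left (Real.rpow_le_rpow_of_exponent_le hN1 hgg') (le_max_right _ _)
  linarith

/-- **SHRINKING THE WINDOW IS FREE**: `(HM[τ,w]_a) ⟹ (HM[τ,w']_a)` whenever eventually `w' ≤ w`. [formal bookkeeping] -/
theorem HorizonReturnMonotoneWithin.of_window_le {a : ℝ} {τ : ℕ → ℝ} {w w' : ℝ → ℕ → ℝ}
    (hw : ∀ T : ℝ, 0 < T → ∃ N₀ : ℕ, ∀ N : ℕ, N₀ ≤ N → w' T N ≤ w T N) (h : HorizonReturnMonotoneWithin a τ w) :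
    HorizonReturnMonotoneWithin a τ w' := by
  intro ω₂ lam β γ hω hl hβ hγ T hT c hc
  obtain ⟨N₀, hN₀⟩ := h ω₂ lam β γ hω hl hβ hγ T hT c hc
  obtain ⟨N₁, hN₁⟩ := hw T hT
  refine ⟨max N₀ N₁, fun N hN => ?_⟩
  obtain ⟨R, hmono, hae⟩ := hN₀ N (le_trans (le_max_left _ _) hN)
  exact ⟨R, fun k₁ k₂ h12 h2 => hmono k₁ k₂ h12 (h2.trans (hN₁ N (le_trans (le_max_right _ _) hN))), hae⟩

/-- **The free budget at a general horizon** (`N ≥ 1`, `0 ≤ a`, `0 < c`, `τ ≥ 0`):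
`∫ (𝔊^{aN,cN²;τ}_N)² dν_T ≤ (c+4a)²·(∫(k²−T)²dν_T)·(N⁴·τ²)`. [this cell] -/
theorem horizonReturnProfile_sq_le_horizon (hω : 0 < ω₂) (hl : 0 < lam) (hβ : 0 < β) (hγ : 0 < γ) (hT : 0 < T) (n : ℕ)
    {a c Nr τv : ℝ} (ha : 0 ≤ a) (hc : 0 < c) (hNr1 : 1 ≤ Nr) (hτ : 0 ≤ τv) :
    Integrable (fun k => horizonReturnProfile ω₂ lam β γ T (n + 1) (a * Nr) (c * Nr ^ 2) τv k ^ 2) (gaussianReal 0 T.toNNReal) ∧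
    ∫ k, horizonReturnProfile ω₂ lam β γ T (n + 1) (a * Nr) (c * Nr ^ 2) τv k ^ 2 ∂(gaussianReal 0 T.toNNReal) ≤
      ((c + 4 * a) ^ 2 * ∫ k, (k ^ 2 - T) ^ 2 ∂(gaussianReal 0 T.toNNReal)) * (Nr ^ 4 * τv ^ 2) := by
  have hNr0 : 0 ≤ Nr := by linarith
  obtain ⟨K0, hK0⟩ : ∃ x : ℝ, x = ∫ k, (k ^ 2 - T) ^ 2 ∂(gaussianReal 0 T.toNNReal) := ⟨_, rfl⟩
  have hK00 : 0 ≤ K0 := by rw [hK0]; exact integral_nonneg fun k => sq_nonneg _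
  obtain ⟨hI, hle⟩ := horizonReturnProfile_sq_le hω hl hβ hγ hT n (a * Nr) (c * Nr ^ 2) hτ
  rw [← hK0] at hle ⊢
  refine ⟨hI, hle.trans ?_⟩
  have hs : 0 ≤ a * Nr := mul_nonneg ha hNr0
  have ht : 0 ≤ c * Nr ^ 2 := by positivity
  have hW : |c * Nr ^ 2| + 4 * |a * Nr| ≤ (c + 4 * a) * Nr ^ 2 := by
    rw [abs_of_nonneg ht, abs_of_nonneg hs]
    nlinarith
  have hW0 : 0 ≤ |c * Nr ^ 2| + 4 * |a * Nr| := by positivity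
  calc (|c * Nr ^ 2| + 4 * |a * Nr|) ^ 2 * τv ^ 2 * K0 ≤ ((c + 4 * a) * Nr ^ 2) ^ 2 * τv ^ 2 * K0 := by gcongr
    _ = (c + 4 * a) ^ 2 * K0 * (Nr ^ 4 * τv ^ 2) := by ring

/-- **The log-window identities** (`N ≥ 1`, `τ_N ≥ 1`, `T > 0`): `W_T(τ;N) ≥ 4T` and `N⁴·τ_N²·e^{−W_T(τ;N)/(8T)} ≤ 1` (`= e^{−1}`). [elementary] -/
theorem logWindow_facts (hT : 0 < T) {τ : ℕ → ℝ} {N : ℕ} (hN : 1 ≤ N) (hτ : 1 ≤ τ N) :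
    4 * T ≤ logWindow τ T N ∧ ((N : ℝ) ^ 4 * τ N ^ 2) * Real.exp (-(logWindow τ T N / (8 * T))) ≤ 1 := by
  have hN1 : (1 : ℝ) ≤ N := by exact_mod_cast hN
  have hN0 : (0 : ℝ) < N := by linarith
  have hτ0 : 0 < τ N := by linarith
  have hlτ : 0 ≤ Real.log (τ N) := Real.log_nonneg hτ
  have hlN : 0 ≤ Real.log (N : ℝ) := Real.log_nonneg hN1
  have hT0 : T ≠ 0 := hT.ne'
  obtain ⟨X, hX⟩ : ∃ X : ℝ, X = 2 * Real.log (τ N) + 4 * Real.log N + 1 := ⟨_, rfl⟩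
  have hWX : logWindow τ T N = 8 * T * X := by rw [hX]; rfl
  constructor
  · rw [hWX]; nlinarith
  · have hdiv : logWindow τ T N / (8 * T) = X := by
      rw [hWX]; field_simp
    rw [hdiv]
    have hP : (N : ℝ) ^ 4 * τ N ^ 2 = Real.exp (2 * Real.log (τ N) + 4 * Real.log N) := by
      rw [Real.exp_add, show (2 : ℝ) * Real.log (τ N) = ((2 : ℕ) : ℝ) * Real.log (τ N) by norm_num,
        show (4 : ℝ) * Real.log (N : ℝ) = ((4 : ℕ) : ℝ) * Real.log (N : ℝ) by norm_num, Real.exp_nat_mul, Real.exp_nat_mul,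
        Real.exp_log hτ0, Real.exp_log hN0]
      ring
    rw [hP, ← Real.exp_add, Real.exp_le_one_iff, hX]
    linarith

/-- **Scales bookkeeping**: if `τ_N ≥ N³` for all `N`, then for `N ≥ max(c, 2a)` and `N ≥ 1`: `cN² ≤ τ_N`, `2aN ≤ τ_N`, `1 ≤ τ_N`. [elementary] -/
theorem horizon_scales {a c : ℝ} {τ : ℕ → ℝ} (hτ3 : ∀ N : ℕ, (N : ℝ) ^ 3 ≤ τ N) {N₄ : ℕ} (hN₄ : max c (2 * a) ≤ N₄)
    {N : ℕ} (hNN₄ : N₄ ≤ N) (hN1 : 1 ≤ N) : c * (N : ℝ) ^ 2 ≤ τ N ∧ 2 * (a * N) ≤ τ N ∧ 1 ≤ τ N := by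
  have hN1r : (1 : ℝ) ≤ N := by exact_mod_cast hN1
  have hN0 : (0 : ℝ) ≤ N := by linarith
  have hN4r : ((N₄ : ℕ) : ℝ) ≤ N := by exact_mod_cast hNN₄
  have hcN : c ≤ N := le_trans (le_trans (le_max_left _ _) hN₄) hN4r
  have haN : 2 * a ≤ N := le_trans (le_trans (le_max_right _ _) hN₄) hN4r
  have h3 := hτ3 N
  have hN3 : (N : ℝ) ^ 3 = N * (N * N) := by ring
  refine ⟨le_trans ?_ h3, le_trans ?_ h3, le_trans (one_le_pow₀ hN1r) h3⟩
  · rw [hN3, sq]; exact mul_le_mul_of_nonneg_right hcN (mul_nonneg hN0 hN0)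
  · rw [hN3]
    calc 2 * (a * N) = (2 * a) * N := by ring
      _ ≤ N * N := mul_le_mul_of_nonneg_right haN hN0
      _ = N * (N * 1) := by ring
      _ ≤ N * (N * N) := mul_le_mul_of_nonneg_left (mul_le_mul_of_nonneg_left hN1r hN0) hN0

/-- ★★ **THE LOCAL DOOR — THE LOG-WINDOW LAW** (fixed parameters; `0 ≤ a`, `0 < c`). If along a horizon sequence `τ` (eventually `τ_N ≥ cN²`,
`τ_N ≥ 2aN`, `τ_N ≥ 1`) the remainder is floored at grade one, `γ²N²·Rem_N(τ_N) ≥ −C₁·N`, and the horizon heat-return curve `𝔊^{aN,cN²;τ_N}_N` is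
a.e. nondecreasing in `k²` on the LOG WINDOW `k² ≤ W_T(τ;N)`, then `B^late_N(aN, cN²) ≥ −C·N` eventually.  The horizon and the window enter ONLY
through `W_T(τ;N) = 16T·log τ_N + 32T·log N + 8T`: every e-fold of horizon costs sixteen thermal energies of confinement. Proof = NODE 112's horizon
split (`bathTailLate_ge_horizon`) + free budget `O(N⁴τ_N²)` + the GAUSSIAN confinement lemma. [this cell; NEW] -/
theorem bathTailLate_floor_of_logWindow (hω : 0 < ω₂) (hl : 0 < lam) (hβ : 0 < β) (hγ : 0 < γ) (hT : 0 < T) {a c : ℝ}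
    (ha : 0 ≤ a) (hc : 0 < c) {τ : ℕ → ℝ} {C₁ : ℝ} {N₁ : ℕ}
    (hτ : ∀ N : ℕ, N₁ ≤ N → c * (N : ℝ) ^ 2 ≤ τ N ∧ 2 * (a * N) ≤ τ N ∧ 1 ≤ τ N)
    (hrem : ∀ N : ℕ, N₁ ≤ N → -(C₁ * (N : ℝ)) ≤ γ ^ 2 * (N : ℝ) ^ 2 * bathKinRem ω₂ lam β γ T N (τ N))
    (hmono : ∀ N : ℕ, N₁ ≤ N → ∃ R : ℝ → ℝ,
      (∀ k₁ k₂ : ℝ, k₁ ^ 2 ≤ k₂ ^ 2 → k₂ ^ 2 ≤ logWindow τ T N → R k₁ ≤ R k₂) ∧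
        horizonReturnProfile ω₂ lam β γ T N (a * (N : ℝ)) (c * (N : ℝ) ^ 2) (τ N) =ᵐ[gaussianReal 0 T.toNNReal] R) :
    ∃ C : ℝ, ∀ N : ℕ, max N₁ 1 ≤ N → -(C * (N : ℝ)) ≤ bathTailLate ω₂ lam β γ T N (a * (N : ℝ)) (c * (N : ℝ) ^ 2) := by
  obtain ⟨A, hA0, hA⟩ := thermalCrossDefect_le_of_monotoneSqOn_exp hT
  obtain ⟨B, hB⟩ : ∃ x : ℝ, x = (c + 4 * a) ^ 2 * ∫ k, (k ^ 2 - T) ^ 2 ∂(gaussianReal 0 T.toNNReal) := ⟨_, rfl⟩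
  have hB0 : 0 ≤ B := by rw [hB]; exact mul_nonneg (sq_nonneg _) (integral_nonneg fun k => sq_nonneg _)
  obtain ⟨C₂, hC₂⟩ : ∃ x : ℝ, x = γ ^ 2 * (A * (1 + B)) := ⟨_, rfl⟩
  have hC₂0 : 0 ≤ C₂ := by rw [hC₂]; positivity
  refine ⟨c * C₁ + C₂, fun N hN => ?_⟩
  have hNN₁ : N₁ ≤ N := le_trans (le_max_left _ _) hN
  have hN1 : 1 ≤ N := le_trans (le_max_right _ _) hN
  obtain ⟨hτc, hτa, hτ1⟩ := hτ N hNN₁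
  have hZ1 := hrem N hNN₁
  obtain ⟨R, hRmono, hRae⟩ := hmono N hNN₁
  obtain ⟨hW4, hPW⟩ := logWindow_facts hT hN1 hτ1
  obtain ⟨n, rfl⟩ : ∃ n, N = n + 1 := ⟨N - 1, by omega⟩
  -- make the window, the horizon value and `(N : ℝ)` opaque
  obtain ⟨W, hWdef⟩ : ∃ x : ℝ, x = logWindow τ T (n + 1) := ⟨_, rfl⟩
  obtain ⟨τv, hτv⟩ : ∃ x : ℝ, x = τ (n + 1) := ⟨_, rfl⟩
  obtain ⟨Nr, hNr⟩ : ∃ x : ℝ, x = ((n + 1 : ℕ) : ℝ) := ⟨_, rfl⟩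
  rw [← hWdef] at hRmono hW4 hPW
  rw [← hτv] at hτc hτa hτ1 hZ1 hRae hPW
  rw [← hNr] at hτc hτa hZ1 hRae hPW
  rw [← hNr]
  have hNr1 : (1 : ℝ) ≤ Nr := by rw [hNr]; exact_mod_cast hN1
  have hNr0 : (0 : ℝ) < Nr := by linarith
  have hs : 0 ≤ a * Nr := mul_nonneg ha hNr0.le
  have ht : 0 ≤ c * Nr ^ 2 := by positivity
  -- the pointwise door of NODE 112 at horizon `τ_N`
  have hdoor := bathTailLate_ge_horizon hω hl hβ hγ hT n hs ht hτc hτa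
  -- the remainder piece
  have hrem' : -(c * C₁ * Nr) ≤ γ ^ 2 * (c * Nr ^ 2) * bathKinRem ω₂ lam β γ T (n + 1) τv := by
    have h' := mul_le_mul_of_nonneg_left hZ1 hc.le
    calc -(c * C₁ * Nr) = c * -(C₁ * Nr) := by ring
      _ ≤ c * (γ ^ 2 * Nr ^ 2 * bathKinRem ω₂ lam β γ T (n + 1) τv) := h'
      _ = _ := by ring
  -- the defect: free budget `B·(N⁴τ²)` against the Gaussian gain of the log window
  have hdef : γ ^ 2 * thermalCrossDefect T (horizonReturnProfile ω₂ lam β γ T (n + 1) (a * Nr) (c * Nr ^ 2) τv) ≤ C₂ * Nr := by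
    obtain ⟨h𝔊2, h𝔊le⟩ := horizonReturnProfile_sq_le_horizon hω hl hβ hγ hT n ha hc hNr1 (zero_le_one.trans hτ1)
    rw [← hB] at h𝔊le
    have h𝔊m : AEStronglyMeasurable (horizonReturnProfile ω₂ lam β γ T (n + 1) (a * Nr) (c * Nr ^ 2) τv)
        (gaussianReal 0 T.toNNReal) := by
      rw [horizonReturnProfile_succ]
      exact (stronglyMeasurable_kickAvg hω hl.le hβ.le γ hT n
        (stronglyMeasurable_horizonCumFcast (T := T) hω hl hβ hγ n _ _ _).measurable).aestronglyMeasurable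
    have hP1 : (1 : ℝ) ≤ Nr ^ 4 * τv ^ 2 := one_le_mul_of_one_le_of_one_le (one_le_pow₀ hNr1) (one_le_pow₀ hτ1)
    have h := thermalCrossDefect_le_of_confined_exp hT hA0 hA hW4 h𝔊m h𝔊2 h𝔊le hB0 hP1 hPW hRmono hRae
    calc _ ≤ γ ^ 2 * (A * (1 + B)) := mul_le_mul_of_nonneg_left h (sq_nonneg γ)
      _ = C₂ * 1 := by rw [hC₂, mul_one]
      _ ≤ C₂ * Nr := mul_le_mul_of_nonneg_left hNr1 hC₂0
  have e : (c * C₁ + C₂) * Nr = c * C₁ * Nr + C₂ * Nr := by ring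
  rw [e]
  linarith

/-- ★★★ **THE GENERAL DOOR OF NODE 113 — horizon and window free** (`0 ≤ a`, `τ_N ≥ N³`):
`(HZᶠ[τ]_1) ∧ (HM[τ, W_T(τ)]_a) ⟹ LateTailFloor a 1 1` — the horizon-remainder floor at grade one along ANY superquadratic horizon, and confined
monotonicity of the horizon heat-return curve on that horizon's LOG WINDOW `k² ≤ 16T·log τ_N + 32T·log N + 8T`.  NODE 112's door is the point
`τ_N = N^q`, window `T·N^δ ⊋ W_T(N^q) = 8T((2q+4)log N + 1)`. [this cell; NEW] -/
theorem lateTailFloor_one_of_horizonAt_logWindow {a : ℝ} {τ : ℕ → ℝ} (ha : 0 ≤ a) (hτ3 : ∀ N : ℕ, (N : ℝ) ^ 3 ≤ τ N)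
    (hZ : HorizonRemainderFloorAt τ 1) (hM : HorizonReturnMonotoneWithin a τ (logWindow τ)) : LateTailFloor a 1 1 := by
  intro ω₂ lam β γ hω hl hβ hγ T hT c hc
  obtain ⟨C₁, N₁, hC₁⟩ := hZ ω₂ lam β γ hω hl hβ hγ T hT
  obtain ⟨N₂, hN₂⟩ := hM ω₂ lam β γ hω hl hβ hγ T hT c hc
  obtain ⟨N₄, hN₄⟩ := exists_nat_ge (max c (2 * a))
  have hτ' : ∀ N : ℕ, max (max N₁ N₂) (max N₄ 1) ≤ N → c * (N : ℝ) ^ 2 ≤ τ N ∧ 2 * (a * N) ≤ τ N ∧ 1 ≤ τ N :=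
    fun N hN => horizon_scales hτ3 hN₄ (le_trans (le_trans (le_max_left _ _) (le_max_right _ _)) hN)
      (le_trans (le_trans (le_max_right _ _) (le_max_right _ _)) hN)
  have hrem : ∀ N : ℕ, max (max N₁ N₂) (max N₄ 1) ≤ N →
      -(C₁ * (N : ℝ)) ≤ γ ^ 2 * (N : ℝ) ^ 2 * bathKinRem ω₂ lam β γ T N (τ N) := by
    intro N hN
    have h := hC₁ N (le_trans (le_trans (le_max_left _ _) (le_max_left _ _)) hN)
    rwa [Real.rpow_one] at h
  obtain ⟨C, hC⟩ := bathTailLate_floor_of_logWindow hω hl hβ hγ hT ha hc hτ' hrem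
    (fun N hN => hN₂ N (le_trans (le_trans (le_max_right _ _) (le_max_left _ _)) hN))
  refine ⟨C, max (max (max N₁ N₂) (max N₄ 1)) 1, fun N hN => ?_⟩
  rw [Real.rpow_one]
  exact hC N hN

/-- ★ NODE 113's general door lands on the blocker: `(S) ∧ (HZᶠ[τ]_1) ∧ (HM[τ, W_T(τ)]_a) ⟹ BoundedResponse` (stmt-11071). [this cell] -/
theorem boundedResponse_of_subdiffusiveBondHeat_horizonAt {a : ℝ} {τ : ℕ → ℝ} (ha : 0 ≤ a) (hτ3 : ∀ N : ℕ, (N : ℝ) ^ 3 ≤ τ N)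
    (hS : Theses.BondHeatUncertainty.SubdiffusiveBondHeat) (hZ : HorizonRemainderFloorAt τ 1)
    (hM : HorizonReturnMonotoneWithin a τ (logWindow τ)) : Theses.BondHeatUncertainty.BoundedResponse :=
  boundedResponse_of_subdiffusiveBondHeat_lateTailFloor ha le_rfl hS (lateTailFloor_one_of_horizonAt_logWindow ha hτ3 hZ hM)

/-- ★ **`(HM[τ,w]_a)` ⟸ CONFINED pointwise `(ER↑)` WITHIN THE HORIZON AND THE WINDOW** — the instrumentable sufficient condition (census KICK
readouts): eventually in `N`, for every lag `aN < u ≤ τ_N` and all kicks `k₁² ≤ k₂² ≤ w(T,N)`, `Ḡ_{N,u}(k₁) ≤ Ḡ_{N,u}(k₂)` (NODE 110's energy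
response curve `kinKickProfile`). [this cell] -/
theorem horizonReturnMonotoneWithin_of_kinKickProfile_monoOn {a : ℝ} {τ : ℕ → ℝ} {w : ℝ → ℕ → ℝ} (ha : 0 ≤ a)
    (h : ∀ ω₂ lam β γ : ℝ, 0 < ω₂ → 0 < lam → 0 < β → 0 < γ → ∀ T : ℝ, 0 < T →
      ∃ N₀ : ℕ, ∀ N : ℕ, N₀ ≤ N → ∀ u : ℝ, a * N < u → u ≤ τ N → ∀ k₁ k₂ : ℝ, k₁ ^ 2 ≤ k₂ ^ 2 →
        k₂ ^ 2 ≤ w T N → kinKickProfile ω₂ lam β γ T N u k₁ ≤ kinKickProfile ω₂ lam β γ T N u k₂) :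
    HorizonReturnMonotoneWithin a τ w := by
  intro ω₂ lam β γ hω hl hβ hγ T hT c hc
  obtain ⟨N₀, hN₀⟩ := h ω₂ lam β γ hω hl hβ hγ T hT
  refine ⟨N₀ + ⌈2 * a / c⌉₊ + 1, fun N hN => ⟨_, fun k₁ k₂ hk hX => ?_, Eventually.of_forall fun k => rfl⟩⟩
  obtain ⟨n, rfl⟩ : ∃ n, N = n + 1 := ⟨N - 1, by omega⟩
  have hs : 0 ≤ a * ((n + 1 : ℕ) : ℝ) := by positivity
  have hNc : 2 * a / c ≤ ((n + 1 : ℕ) : ℝ) :=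
    (Nat.le_ceil _).trans (by exact_mod_cast (show ⌈2 * a / c⌉₊ ≤ n + 1 by omega))
  have hst : 2 * (a * ((n + 1 : ℕ) : ℝ)) ≤ c * ((n + 1 : ℕ) : ℝ) ^ 2 := by
    have hN0 : (0 : ℝ) ≤ ((n + 1 : ℕ) : ℝ) := by positivity
    have h2 : 2 * a ≤ ((n + 1 : ℕ) : ℝ) * c := by rwa [div_le_iff₀ hc] at hNc
    nlinarith
  exact horizonReturnProfile_monoOn_of_kinKickProfile_monoOn hω hl hβ hγ hT n hs hst
    (fun u hu huτ k₁' k₂' hk' hX' => hN₀ (n + 1) (by omega) u hu huτ k₁' k₂' hk' hX') k₁ k₂ hk hX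

/-! ### §10b The polynomial horizon with its LOGARITHMIC window: `(HMlog_{a,q})`, provably weaker than NODE 112's `(HM_{a,q,δ})` -/

/-- **(HMlog_{a,q}) `HorizonReturnMonotoneLog a q`** — NODE 112's confined monotonicity at the polynomial horizon `N^q`, asked only on the
LOGARITHMIC window `k² ≤ 8T·((2q+4)·log N + 1) = W_T(N^q; N)` instead of the power window `k² ≤ T·N^δ`: «kicks harder than `√((16q+32)·log N + 8)`
thermal momenta are free».  PROVABLY WEAKER than every `(HM_{a,q,δ})`, `δ > 0` (`horizonReturnMonotoneLog_of_on`); with `(HZᶠ_{q,1})` it still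
gives the floor (`lateTailFloor_one_of_horizon_log`).  Tag: UNDECIDED · INSTRUMENTABLE (KICK readouts on `k² ≤ 8T((2q+4)log N + 1)`, lags
`aN < u ≤ N^q`) · IDEA-NEEDED (phonon-TRUE). [route statement · this cell; NOT a literature fact] -/
def HorizonReturnMonotoneLog (a : ℝ) (q : ℕ) : Prop :=
  HorizonReturnMonotoneWithin a (fun N => (N : ℝ) ^ q) (fun T N => 8 * T * ((2 * (q : ℝ) + 4) * Real.log N + 1))

/-- The log window of the polynomial horizon: `W_T(N^q; N) = 8T·((2q+4)·log N + 1)`. [elementary] -/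
theorem logWindow_pow (q : ℕ) (T : ℝ) (N : ℕ) :
    logWindow (fun N => (N : ℝ) ^ q) T N = 8 * T * ((2 * (q : ℝ) + 4) * Real.log N + 1) := by
  simp only [logWindow, Real.log_pow]
  ring

/-- ★★★ **THE LOG-WINDOW DOOR AT POLYNOMIAL HORIZON** (`0 ≤ a`, `3 ≤ q`): `(HZᶠ_{q,1}) ∧ (HMlog_{a,q}) ⟹ LateTailFloor a 1 1` — NODE 112's door
with its confinement window shrunk from `T·N^δ` to `8T((2q+4)·log N + 1)`. [this cell; NEW] -/
theorem lateTailFloor_one_of_horizon_log {a : ℝ} {q : ℕ} (ha : 0 ≤ a) (hq : 3 ≤ q)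
    (hZ : HorizonRemainderFloor q 1) (hM : HorizonReturnMonotoneLog a q) : LateTailFloor a 1 1 := by
  refine lateTailFloor_one_of_horizonAt_logWindow (τ := fun N => (N : ℝ) ^ q) ha (fun N => ?_)
    ((horizonRemainderFloor_iff_at q 1).1 hZ) ?_
  · show (N : ℝ) ^ 3 ≤ (N : ℝ) ^ q
    rcases Nat.eq_zero_or_pos N with h0 | hpos
    · subst h0
      have hq0 : q ≠ 0 := by omega
      simp [hq0]
    · exact pow_le_pow_right₀ (by exact_mod_cast hpos) hq
  · exact HorizonReturnMonotoneWithin.of_window_le (fun T _ => ⟨0, fun N _ => (logWindow_pow q T N).le⟩) hM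

/-- ★ NODE 113's log-window door lands on the blocker: `(S) ∧ (HZᶠ_{q,1}) ∧ (HMlog_{a,q}) ⟹ BoundedResponse` (stmt-11071). [this cell] -/
theorem boundedResponse_of_subdiffusiveBondHeat_horizon_log {a : ℝ} {q : ℕ} (ha : 0 ≤ a) (hq : 3 ≤ q)
    (hS : Theses.BondHeatUncertainty.SubdiffusiveBondHeat) (hZ : HorizonRemainderFloor q 1) (hM : HorizonReturnMonotoneLog a q) :
    Theses.BondHeatUncertainty.BoundedResponse :=
  boundedResponse_of_subdiffusiveBondHeat_lateTailFloor ha le_rfl hS (lateTailFloor_one_of_horizon_log ha hq hZ hM)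

/-- An elementary eventuality: `8·((2q+4)·log N + 1) ≤ N^δ` for `N ≥ N₁(q,δ)` (`δ > 0`; `log = o(x^δ)`). [elementary] -/
theorem eventually_logWindow_le_rpow (q : ℕ) {δ : ℝ} (hδ : 0 < δ) :
    ∃ N₁ : ℕ, ∀ N : ℕ, N₁ ≤ N → 8 * ((2 * (q : ℝ) + 4) * Real.log N + 1) ≤ (N : ℝ) ^ δ := by
  have hq0 : (0 : ℝ) < 2 * q + 4 := by positivity
  have hκ : (0 : ℝ) < 1 / (16 * (2 * q + 4)) := by positivity
  have h := (isLittleO_log_rpow_atTop hδ).bound hκ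
  have h16 : Tendsto (fun x : ℝ => x ^ δ) atTop atTop := tendsto_rpow_atTop hδ
  obtain ⟨X, hX⟩ := Filter.eventually_atTop.1 ((h.and (Filter.eventually_ge_atTop 1)).and (h16.eventually_ge_atTop 16))
  obtain ⟨N₁, hN₁⟩ := exists_nat_ge X
  refine ⟨N₁, fun N hN => ?_⟩
  have hNX : X ≤ (N : ℝ) := hN₁.trans (by exact_mod_cast hN)
  obtain ⟨⟨hlog, h1⟩, h16'⟩ := hX (N : ℝ) hNX
  have hN0 : (0 : ℝ) < N := by linarith
  rw [Real.norm_eq_abs, Real.norm_eq_abs, abs_of_nonneg (Real.log_nonneg h1),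
    abs_of_nonneg (Real.rpow_nonneg hN0.le _)] at hlog
  have h2 : 8 * ((2 * (q : ℝ) + 4) * Real.log N) ≤ (N : ℝ) ^ δ / 2 := by
    have h3 := mul_le_mul_of_nonneg_left hlog (by positivity : (0 : ℝ) ≤ 8 * (2 * q + 4))
    calc 8 * ((2 * (q : ℝ) + 4) * Real.log N) = 8 * (2 * q + 4) * Real.log N := by ring
      _ ≤ 8 * (2 * q + 4) * (1 / (16 * (2 * q + 4)) * (N : ℝ) ^ δ) := h3
      _ = (N : ℝ) ^ δ / 2 := by field_simp; ring
  calc 8 * ((2 * (q : ℝ) + 4) * Real.log N + 1) = 8 * ((2 * (q : ℝ) + 4) * Real.log N) + 8 := by ring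
    _ ≤ (N : ℝ) ^ δ / 2 + (N : ℝ) ^ δ / 2 := add_le_add h2 (by linarith)
    _ = (N : ℝ) ^ δ := by ring

/-- ★ **NODE 112's piece implies NODE 113's**: `(HM_{a,q,δ}) ⟹ (HMlog_{a,q})` for every `δ > 0` (the log window is eventually inside the
power window).  The converse is not claimed. [this cell] -/
theorem horizonReturnMonotoneLog_of_on {a δ : ℝ} {q : ℕ} (hδ : 0 < δ) (h : HorizonReturnMonotoneOn a q δ) :
    HorizonReturnMonotoneLog a q := by
  obtain ⟨N₁, hN₁⟩ := eventually_logWindow_le_rpow q hδ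
  refine HorizonReturnMonotoneWithin.of_window_le (fun T hT => ⟨N₁, fun N hN => ?_⟩)
    ((horizonReturnMonotoneOn_iff_within a q δ).1 h)
  show 8 * T * ((2 * (q : ℝ) + 4) * Real.log N + 1) ≤ T * (N : ℝ) ^ δ
  have := mul_le_mul_of_nonneg_left (hN₁ N hN) hT.le
  calc 8 * T * ((2 * (q : ℝ) + 4) * Real.log N + 1) = T * (8 * ((2 * (q : ℝ) + 4) * Real.log N + 1)) := by ring
    _ ≤ T * (N : ℝ) ^ δ := this

/-- ★ `(HMlog_{a,q})` ⟸ confined pointwise `(ER↑)` on the log window (census KICK readouts `Ḡ_{N,u}(k)`, `aN < u ≤ N^q`,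
`k² ≤ 8T((2q+4)log N + 1)`). [this cell] -/
theorem horizonReturnMonotoneLog_of_kinKickProfile_monoOn {a : ℝ} {q : ℕ} (ha : 0 ≤ a)
    (h : ∀ ω₂ lam β γ : ℝ, 0 < ω₂ → 0 < lam → 0 < β → 0 < γ → ∀ T : ℝ, 0 < T →
      ∃ N₀ : ℕ, ∀ N : ℕ, N₀ ≤ N → ∀ u : ℝ, a * N < u → u ≤ (N : ℝ) ^ q → ∀ k₁ k₂ : ℝ, k₁ ^ 2 ≤ k₂ ^ 2 →
        k₂ ^ 2 ≤ 8 * T * ((2 * (q : ℝ) + 4) * Real.log N + 1) →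
          kinKickProfile ω₂ lam β γ T N u k₁ ≤ kinKickProfile ω₂ lam β γ T N u k₂) :
    HorizonReturnMonotoneLog a q :=
  horizonReturnMonotoneWithin_of_kinKickProfile_monoOn ha h

/-- ★ **`(KD_p)` feeds the log-window door** (`0 ≤ a`, `3 ≤ q`, `p < q`): `(KD_p) ∧ (HMlog_{a,q}) ⟹ LateTailFloor a 1 1`
(NODE 112's `horizonRemainderFloor_of_kernelDecay`). [this cell] -/
theorem lateTailFloor_one_of_kernelDecay_log {a p : ℝ} {q : ℕ} (ha : 0 ≤ a) (hq : 3 ≤ q) (hpq : p < q)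
    (hK : BathKernelHorizonDecay p) (hM : HorizonReturnMonotoneLog a q) : LateTailFloor a 1 1 :=
  lateTailFloor_one_of_horizon_log ha hq (horizonRemainderFloor_of_kernelDecay hpq hK 1) hM

end LogWindow

end Summit.AtomisticToContinuum.FouriersLaw.Theorems.BoundedResponse.HeatSpreading

end
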